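import Summits.Ventures.PercRepro.S1CoreCapEightExact

/-!
# PercRepro — THE `s₄` TABLE WITH THE EXACT `Q*(8) = 23` (p1, gen 29)

The consequences of `Eight.fourCapSpec_eight_exact : FourCapSpec capPaper 8 23` on the e-free core: the
spec instances `j ≤ 8` with the table `0, 1, 4, 5, 8, 11, 16, 19, 23` (`fourCapSpec_exact_le_eight`), at most
`23` 4-circuits through any point of a core of nullity `8` (`ncard_fourCircuitsThrough_le_twenty_three`, from
`25`), `s₄ ≤ 87` at nullity `8` (`ncard_fourCircuits_le_eighty_seven`, from `89`; the sum `capSum … 8 = 87` by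
`decide`), and one averaging step of `S1CoreCapAvg`: `s₄ ≤ ⌊14 · 87 / 10⌋ = 121` at nullity `9`
(`ncard_fourCircuits_le_one_hundred_twenty_one`, from `124`). `proofs/P1-S4-CAPBRIDGE.md` §21.
Axioms: standard.
-/

open scoped Matroid

namespace PercRepro

namespace S1

open Set

open FourCap

variable {α : Type}

/-- The instances `j ≤ 8` of the spec with the exact value at `8`: `0, 1, 4, 5, 8, 11, 16, 19, 23`. -/
theorem fourCapSpec_exact_le_eight : ∀ j ≤ 8, FourCapSpec capPaper j (if j = 8 then 23 else qStar j) := by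
  intro j hj
  rcases (by omega : j ≤ 7 ∨ j = 8) with h | rfl
  · rw [if_neg (by omega)]
    exact fourCapSpec_qStar_le_seven_unconditional j h
  · rw [if_pos rfl]
    exact Eight.fourCapSpec_eight_exact

/-- `Σ_{j ≤ 8} (0, 1, 4, 5, 8, 11, 16, 19, 23) = 87`. -/
theorem capSum_exact_eight : capSum (fun j => if j = 8 then 23 else qStar j) 8 = 87 := by decide

/-- **At most `23` 4-circuits through any point of an e-free core of nullity `8`** (from `25`). -/
theorem ncard_fourCircuitsThrough_le_twenty_three (M : Matroid α) [M.Finite]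
    (hfree : ∀ e ∈ M.E, ∃ A ⊆ M.E \ {e}, e ∉ M.closure A ∧ e ∉ M.closure ((M.E \ {e}) \ A))
    (hd : M.E.encard = M.eRank + 8) {e : α} (he : e ∈ M.E) :
    {C : Set α | M.IsCircuit C ∧ C.ncard = 4 ∧ e ∈ C}.ncard ≤ 23 :=
  ncard_fourCircuitsThrough_le_of_fourCapSpec M hfree hd he Eight.fourCapSpec_eight_exact

/-- **`s₄ ≤ 87` on every e-free core of nullity `8`** (from `89`). -/
theorem ncard_fourCircuits_le_eighty_seven (M : Matroid α) [M.Finite]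
    (hfree : ∀ e ∈ M.E, ∃ A ⊆ M.E \ {e}, e ∉ M.closure A ∧ e ∉ M.closure ((M.E \ {e}) \ A))
    (hd : M.E.encard = M.eRank + 8) : {C : Set α | M.IsCircuit C ∧ C.ncard = 4}.ncard ≤ 87 := by
  have := ncard_fourCircuits_le_capSum M hfree hd (fun j => if j = 8 then 23 else qStar j)
    fourCapSpec_exact_le_eight
  rwa [capSum_exact_eight] at this

/-- **`s₄ ≤ 121` on every e-free core of nullity `9`** (from `124`): one averaging step from `87`. -/
theorem ncard_fourCircuits_le_one_hundred_twenty_one (M : Matroid α) [M.Finite]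
    (hfree : ∀ e ∈ M.E, ∃ A ⊆ M.E \ {e}, e ∉ M.closure A ∧ e ∉ M.closure ((M.E \ {e}) \ A))
    (hd : M.E.encard = M.eRank + 9) : {C : Set α | M.IsCircuit C ∧ C.ncard = 4}.ncard ≤ 121 := by
  have h := ncard_fourCircuits_sub_div_le M hfree (d := 8) hd (by omega)
    (fun M' _ hfree' hd' => ncard_fourCircuits_le_eighty_seven M' hfree' hd')
  have h' := le_mul_div_of_sub_div_le (m := 8 + 6) (by omega) h
  exact h'

end S1

end PercRepro
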